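import Literature.Probability.RandomPlanarGeometry.SLESwallowingNearZero
import Literature.Probability.RandomPlanarGeometry.SLETraceHittingMarkov
import HarnessLib

/-!
# Swallowing times of small real points tend to zero (SLE_κ, `κ > 4`), also after an optional time

Topic `Probability/RandomPlanarGeometry`; theorems only. For chordal SLE_κ with `κ > 4` the
swallowing times `T_{xₖ}`, `xₖ = 1/(k+1) ↓ 0`, of small positive real points tend to `0` almost
surely: the trace touches `ℝ ∖ {0}` at arbitrarily small positive times. The probabilistic
content is `ae_forall_exists_swallowingTime_le` (`SLESwallowingNearZero.lean`: a.s. for every `m`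
some `T_{1/(n+1)} ≤ 1/(m+1)`, from `T_x < ∞` a.s. (Lawler (2005), Prop. 6.8) and Brownian scaling
`T_{cx} ∼ c² T_x` (Lawler (2005), Prop. 6.5)); since `x ↦ T_x` is non-decreasing on `(0, ∞)`
(`Loewner.swallowingTime_mono_right`) the whole sequence converges
(`tendsto_swallowingTime_zero_of_forall_exists`, deterministic), which is
`ae_tendsto_swallowingTime_zero`.

For the Markov-type arguments of Rohde–Schramm (2005), §6–7 one needs the same statement for the
driving function **after an optional time** `σ` (a stopping time of the right-continuous Brownian
filtration `𝓕ᵂ₊`), `sleDrivingAfter κ σ ω = √κ (B_{σ+·} - B_σ)`: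

* `ae_brownianIncrAfter_mem_of_ae_brownian_mem` — **transfer of almost sure path properties**: if a
  measurable set `S` of paths (product σ-algebra) contains the Brownian path a.s., then a.s. on
  `{σ < ∞}` it contains `Z^σ = B_{σ+·} - B_σ` (strong Markov property at optional times,
  `measure_brownianIncrAfter_mem_inter_rightCont`);
* `measurableSet_forall_exists_swallowingTime_le` — the countable path-space event
  `⋂ₘ ⋃ₙ {T_{1/(n+1)}[√κ w] ≤ 1/(m+1)}`, read through the measurable regularisation `regPath`, is
  measurable, and `ae_brownian_mem_forall_exists_swallowingTime_le` — it contains the Brownian path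
  a.s.;
* `ae_forall_exists_swallowingTime_sleDrivingAfter_le`,
  `ae_tendsto_swallowingTime_sleDrivingAfter_zero` — a.s. on `{σ < ∞}`,
  `T_{1/(k+1)}[sleDrivingAfter κ σ ω] → 0`;
* `ae_tendsto_swallowingTime_sleDrivingAfter_hitting_zero` — the same at the first hitting time of
  a closed set by the SLE trace (a.s. an optional time,
  `exists_isStoppingTime_rightCont_ae_eq_hitting`).

## References

* G. F. Lawler, *Conformally Invariant Processes in the Plane* (2005), Prop. 6.5, Prop. 6.8, §6.2.
* S. Rohde, O. Schramm, *Basic properties of SLE*, Ann. of Math. 161 (2005), Lemma 6.5, §7 p. 911.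
* J.-F. Le Gall, *Brownian Motion, Martingales, and Stochastic Calculus* (2016), Thm. 2.20.
-/

noncomputable section

open Set Filter MeasureTheory ProbabilityTheory Complex
open _root_.Topology
open scoped NNReal ENNReal

namespace Literature.Probability.RandomPlanarGeometry

open Loewner Literature.Probability.Process

/-! ### Deterministic step: countable form and monotonicity give convergence -/

/-- **From the countable form to convergence.** For a continuous driving function `W` with
`W 0 = 0`: if for every `m` some `T_{1/(n+1)} ≤ 1/(m+1)`, then `T_{1/(k+1)} → 0` as `k → ∞` —
the swallowing time is non-decreasing in the (positive real) point,
`Loewner.swallowingTime_mono_right`, so `T_{1/(k+1)} ≤ T_{1/(n+1)}` for `k ≥ n`. [folklore] -/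
theorem tendsto_swallowingTime_zero_of_forall_exists {W : ℝ≥0 → ℝ} (hW : Continuous W)
    (hW0 : W 0 = 0)
    (h : ∀ m : ℕ, ∃ n : ℕ, swallowingTime W (((1 : ℝ) / ((n : ℝ) + 1) : ℝ) : ℂ) ≤
      ((1 / ((m : ℝ≥0) + 1) : ℝ≥0) : WithTop ℝ≥0)) :
    Tendsto (fun k : ℕ ↦ swallowingTime W (((1 : ℝ) / ((k : ℝ) + 1) : ℝ) : ℂ)) atTop (𝓝 0) := by
  rw [tendsto_order]
  refine ⟨fun a ha ↦ absurd ha not_lt_bot, fun a ha ↦ ?_⟩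
  -- a threshold `1/(m+1) < a`
  obtain ⟨m, hm⟩ : ∃ m : ℕ, ((1 / ((m : ℝ≥0) + 1) : ℝ≥0) : WithTop ℝ≥0) < a := by
    induction a with
    | top => exact ⟨0, WithTop.coe_lt_top _⟩
    | coe r =>
      have hr : 0 < r := by exact_mod_cast ha
      obtain ⟨m, hm⟩ := exists_nat_one_div_lt hr
      exact ⟨m, by exact_mod_cast hm⟩
  obtain ⟨n, hn⟩ := h m
  refine eventually_atTop.2 ⟨n, fun k hk ↦ lt_of_le_of_lt ?_ (hn.trans_lt hm)⟩
  -- monotonicity in the point: `1/(k+1) ≤ 1/(n+1)`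
  refine swallowingTime_mono_right hW (by rw [hW0]; positivity) ?_
  exact one_div_le_one_div_of_le (by positivity) (by exact_mod_cast Nat.succ_le_succ hk)

variable {κ : ℝ≥0} {σ : (ℝ≥0 → ℝ) → WithTop ℝ≥0}

/-! ### Almost surely `T_{1/(k+1)} → 0` -/

/-- **Swallowing times of small points tend to zero, a.s.** For chordal SLE_κ with `κ > 4`,
almost surely `T_{1/(k+1)} → 0` as `k → ∞` (`0 = ⊥` in `WithTop ℝ≥0`, order topology): the trace
touches `ℝ ∖ {0}` at arbitrarily small positive times. Lawler (2005), Prop. 6.8 with the scaling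
rule Prop. 6.5; Rohde–Schramm (2005), Lemma 6.5 and §7. [cite: RohdeSchramm2005, Lemma 6.5] -/
theorem ae_tendsto_swallowingTime_zero (hκ : 4 < κ) :
    ∀ᵐ ω ∂Process.preWienerMeasure, Tendsto (fun k : ℕ ↦
      swallowingTime (sleDriving κ ω) (((1 : ℝ) / ((k : ℝ) + 1) : ℝ) : ℂ)) atTop (𝓝 0) := by
  filter_upwards [ae_forall_exists_swallowingTime_le hκ] with ω hω
  exact tendsto_swallowingTime_zero_of_forall_exists (continuous_sleDriving κ ω)
    (sleDriving_zero κ ω) hω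

/-! ### Transfer of almost sure path properties to the increments after an optional time -/

/-- **Almost sure path properties transfer to `Z^σ = B_{σ+·} - B_σ`.** For a stopping time `σ`
of `𝓕ᵂ₊` and a measurable set `S` of paths containing the Brownian path almost surely: almost
surely on `{σ < ∞}`, `Z^σ ∈ S`. Indeed `P[Z^σ ∈ Sᶜ, σ < ∞] = P[B ∈ Sᶜ] · P[σ < ∞] = 0`
(`measure_brownianIncrAfter_mem_inter_rightCont`). [cite: Legall2016, Thm. 2.20] -/
theorem ae_brownianIncrAfter_mem_of_ae_brownian_mem
    (hσ : IsStoppingTime brownianFiltration.rightCont σ) {S : Set (ℝ≥0 → ℝ)}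
    (hS : MeasurableSet S)
    (hB : ∀ᵐ ω ∂Process.preWienerMeasure, (fun u ↦ Process.brownian u ω) ∈ S) :
    ∀ᵐ ω ∂Process.preWienerMeasure, σ ω ≠ ⊤ → (fun u ↦ brownianIncrAfter σ u ω) ∈ S := by
  have hB' : Process.preWienerMeasure ((fun ω u ↦ Process.brownian u ω) ⁻¹' Sᶜ) = 0 :=
    ae_iff.1 hB
  rw [ae_iff]
  have hset : {ω | ¬ (σ ω ≠ ⊤ → (fun u ↦ brownianIncrAfter σ u ω) ∈ S)} =
      (fun ω u ↦ brownianIncrAfter σ u ω) ⁻¹' Sᶜ ∩ (univ ∩ {ω | σ ω ≠ ⊤}) := by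
    ext ω
    simp only [Classical.not_imp, mem_setOf_eq, mem_inter_iff, mem_preimage, mem_compl_iff,
      mem_univ, true_and]
    exact and_comm
  rw [hset, measure_brownianIncrAfter_mem_inter_rightCont hσ
    (@MeasurableSet.univ _ hσ.measurableSpace) hS.compl, hB', zero_mul]

/-! ### The path-space event and its transfer -/

variable (κ) in
/-- **The countable event `⋂ₘ ⋃ₙ {T_{1/(n+1)}[√κ w] ≤ 1/(m+1)}` is measurable** on the path space
(product σ-algebra), when the swallowing times are read through the measurable regularisation
`regPath` (`= w` for continuous `w` with `w 0 = 0`): each `{t < T_x}` is measurable by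
`Loewner.measurableSet_lt_swallowingTime`. [folklore] -/
theorem measurableSet_forall_exists_swallowingTime_le :
    MeasurableSet {w : ℝ≥0 → ℝ | ∀ m : ℕ, ∃ n : ℕ,
      swallowingTime (fun t ↦ Real.sqrt κ * regPath w t) (((1 : ℝ) / ((n : ℝ) + 1) : ℝ) : ℂ) ≤
        ((1 / ((m : ℝ≥0) + 1) : ℝ≥0) : WithTop ℝ≥0)} := by
  have hc : ∀ w : ℝ≥0 → ℝ, Continuous fun t ↦ Real.sqrt κ * regPath w t := fun w ↦
    continuous_const.mul (continuous_regPath w)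
  have h0 : ∀ w : ℝ≥0 → ℝ, Real.sqrt κ * regPath w 0 = 0 := fun w ↦ by
    rw [regPath_zero, mul_zero]
  rw [setOf_forall]
  refine MeasurableSet.iInter fun m ↦ ?_
  rw [setOf_exists]
  refine MeasurableSet.iUnion fun n ↦ ?_
  have hx : (0 : ℝ) < 1 / ((n : ℝ) + 1) := by positivity
  have hlt := measurableSet_lt_swallowingTime (W := fun (w : ℝ≥0 → ℝ) t ↦ Real.sqrt κ * regPath w t)
    (t := 1 / ((m : ℝ≥0) + 1)) hc h0 (fun s _ ↦ (measurable_regPath s).const_mul _) hx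
  convert hlt.compl using 1
  ext w
  simp only [mem_setOf_eq, mem_compl_iff, not_lt]

/-- **The Brownian path lies in the event a.s.** (`κ > 4`): for `w = B(ω)`, `regPath w = w` and
`√κ w = sleDriving κ ω`, so this is `ae_forall_exists_swallowingTime_le`.
[cite: RohdeSchramm2005, Lemma 6.5] -/
theorem ae_brownian_mem_forall_exists_swallowingTime_le (hκ : 4 < κ) :
    ∀ᵐ ω ∂Process.preWienerMeasure, (fun u ↦ Process.brownian u ω) ∈ {w : ℝ≥0 → ℝ | ∀ m : ℕ,
      ∃ n : ℕ, swallowingTime (fun t ↦ Real.sqrt κ * regPath w t)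
        (((1 : ℝ) / ((n : ℝ) + 1) : ℝ) : ℂ) ≤ ((1 / ((m : ℝ≥0) + 1) : ℝ≥0) : WithTop ℝ≥0)} := by
  filter_upwards [ae_forall_exists_swallowingTime_le hκ] with ω hω
  rw [regPath_eq_self (Process.continuous_brownian ω) (by simp)]
  exact hω

/-- **Countable form after an optional time.** For `κ > 4` and a stopping time `σ` of `𝓕ᵂ₊`:
almost surely on `{σ < ∞}`, for every `m` some `T_{1/(n+1)}[sleDrivingAfter κ σ ω] ≤ 1/(m+1)`
(transfer of `ae_forall_exists_swallowingTime_le` by the strong Markov property at `σ`).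
[cite: RohdeSchramm2005, Lemma 6.5 and §7 p. 911] -/
theorem ae_forall_exists_swallowingTime_sleDrivingAfter_le (hκ : 4 < κ)
    (hσ : IsStoppingTime brownianFiltration.rightCont σ) :
    ∀ᵐ ω ∂Process.preWienerMeasure, σ ω ≠ ⊤ → ∀ m : ℕ, ∃ n : ℕ,
      swallowingTime (sleDrivingAfter κ σ ω) (((1 : ℝ) / ((n : ℝ) + 1) : ℝ) : ℂ) ≤
        ((1 / ((m : ℝ≥0) + 1) : ℝ≥0) : WithTop ℝ≥0) := by
  filter_upwards [ae_brownianIncrAfter_mem_of_ae_brownian_mem hσ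
    (measurableSet_forall_exists_swallowingTime_le κ)
    (ae_brownian_mem_forall_exists_swallowingTime_le hκ)] with ω hω hne
  have h := hω hne
  rw [regPath_eq_self (continuous_brownianIncrAfter σ ω) (brownianIncrAfter_zero σ ω)] at h
  exact h

/-- **Swallowing times of small points tend to zero after an optional time, a.s.** For `κ > 4`
and a stopping time `σ` of the right-continuous Brownian filtration `𝓕ᵂ₊`: almost surely on
`{σ < ∞}`, `T_{1/(k+1)}[sleDrivingAfter κ σ ω] → 0` — the fresh SLE_κ driven by
`√κ (B_{σ+·} - B_σ)` touches `ℝ ∖ {0}` immediately. Rohde–Schramm (2005), Lemma 6.5 and §7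
p. 911 (Markov property at a stopping time); Lawler (2005), Prop. 6.8, §6.2.
[cite: RohdeSchramm2005, Lemma 6.5 and §7 p. 911] -/
theorem ae_tendsto_swallowingTime_sleDrivingAfter_zero (hκ : 4 < κ)
    (hσ : IsStoppingTime brownianFiltration.rightCont σ) :
    ∀ᵐ ω ∂Process.preWienerMeasure, σ ω ≠ ⊤ → Tendsto (fun k : ℕ ↦
      swallowingTime (sleDrivingAfter κ σ ω) (((1 : ℝ) / ((k : ℝ) + 1) : ℝ) : ℂ)) atTop (𝓝 0) := by
  filter_upwards [ae_forall_exists_swallowingTime_sleDrivingAfter_le hκ hσ] with ω hω hne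
  exact tendsto_swallowingTime_zero_of_forall_exists (continuous_sleDrivingAfter ω)
    (by simp [sleDrivingAfter]) (hω hne)

/-- The same for a stopping time of the RAW Brownian filtration `𝓕ᵂ` (which is a stopping time
of `𝓕ᵂ₊`). [cite: RohdeSchramm2005, Lemma 6.5 and §7 p. 911] -/
theorem ae_tendsto_swallowingTime_sleDrivingAfter_zero_of_isStoppingTime (hκ : 4 < κ)
    (hσ : IsStoppingTime brownianFiltration σ) :
    ∀ᵐ ω ∂Process.preWienerMeasure, σ ω ≠ ⊤ → Tendsto (fun k : ℕ ↦
      swallowingTime (sleDrivingAfter κ σ ω) (((1 : ℝ) / ((k : ℝ) + 1) : ℝ) : ℂ)) atTop (𝓝 0) :=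
  ae_tendsto_swallowingTime_sleDrivingAfter_zero hκ fun i ↦
    brownianFiltration.le_rightCont i _ (hσ i)

/-- **At the hitting time of a closed set by the trace.** Under `HasSLETrace κ`, `κ > 4`, for a
closed `A ⊆ ℂ` and `τ_A = hittingAfter (t ω ↦ γ_ω(t)) A 0` the first hitting time of `A` by the
SLE trace: almost surely on `{τ_A < ∞}`, `T_{1/(k+1)}[sleDrivingAfter κ τ_A ω] → 0` (`τ_A` is a.s.
an optional time, `exists_isStoppingTime_rightCont_ae_eq_hitting`, and `sleDrivingAfter` depends on
the time only through its value). Rohde–Schramm (2005), §7 p. 911; Beffara (2008), §3.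
[cite: RohdeSchramm2005, Lemma 6.5 and §7 p. 911] -/
theorem ae_tendsto_swallowingTime_sleDrivingAfter_hitting_zero (h0 : HasSLETrace κ) (hκ : 4 < κ)
    {A : Set ℂ} (hA : IsClosed A) :
    ∀ᵐ ω ∂Process.preWienerMeasure, hittingAfter (fun t ω ↦ sleTrace κ ω t) A 0 ω ≠ ⊤ →
      Tendsto (fun k : ℕ ↦ swallowingTime
        (sleDrivingAfter κ (hittingAfter (fun t ω ↦ sleTrace κ ω t) A 0) ω)
        (((1 : ℝ) / ((k : ℝ) + 1) : ℝ) : ℂ)) atTop (𝓝 0) := by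
  obtain ⟨σ, hσ, hσeq⟩ := exists_isStoppingTime_rightCont_ae_eq_hitting h0 hA
  filter_upwards [hσeq, ae_tendsto_swallowingTime_sleDrivingAfter_zero hκ hσ] with ω hω h hne
  rw [← hω] at hne
  rw [sleDrivingAfter_congr hω.symm]
  exact h hne

end Literature.Probability.RandomPlanarGeometry
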